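import Summits.BirchSwinnertonDyer.BirchSwinnertonDyer.Theorems.KolyvaginRoadThreeSchneiderTamAtThreeHeightLogNumeratorDeepWeierstrassPCore
import HarnessLib

/-!
# Crux `SchneiderTamAtThree` (item 19154) — THE HEIGHT IS THE LOGARITHM OF THE NUMERATOR, DEEP POINTS,
# part 2b/4: `x = ℘(ℓ) − b₂/12` to fourth order — `‖x·ℓ² − 1 + (b₂/12)ℓ² − (c₄/240)ℓ⁴‖₃ ≤ ‖x‖₃⁻²`

HONEST FRAMING (cell `bsd-stepL`, seat `bsd-stepL-tam3-p2` g2, WIDTH-LEVER second lane «closed-form Schneider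
local factor at 3 … finite case table proved once»; `--supports stmt-BirchSwinnertonDyer-19154 --as helper`):
THEOREMS ONLY, unconditional, route-independent (no Theses import); 0 definitions, 0 named facts, 0 sorry;
nothing here proves the crux `SchneiderTamAtThree`, Schneider's conjecture or BSD.

* `norm_x_mul_formalLog_sq_sub_le` — for a `3`-integral Weierstrass equation over `ℚ₃` and a point `(x, y)`
  with `‖x‖₃ ≥ 3⁴` (`‖z‖₃ ≤ 3⁻²`, `z = −x/y`), writing `ℓ = log_W(z)` for the formal logarithm:
  **`‖x·ℓ² − 1 + (b₂/12)·ℓ² − (c₄/240)·ℓ⁴‖₃ ≤ ‖x‖₃⁻²`** — the first three terms of the classical expansion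
  `x = ℘(ℓ) − b₂/12`, `℘(u) = u⁻² + (g₂/20)u² + (g₃/28)u⁴ + …` (`g₂ = c₄/12`), recovered `3`-adically from
  the Weierstrass equation to fourth order (`x z² = 1 − a₁z − a₂z² − a₃z³ + O(z⁴)`) and the formal logarithm
  to fourth order (`ℓ = z + ½a₁z² + ⅓(a₁²+a₂)z³ + ¼(a₁³+2a₁a₂+2a₃)z⁴ + O(z⁵)`, part 1): the EXACT polynomial
  identity `(1 − a₁z − a₂z² − a₃z³)S² − 1 + (b₂/12)z²S² − (c₄/240)z⁴ = Σ_{j=4}^{9} G_j zʲ`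
  (`S = 1 + ½a₁z + ⅓(a₁²+a₂)z² + ¼(a₁³+2a₁a₂+2a₃)z³`) with `G₁ = G₂ = G₃ = 0`,
  `G₄ = (−2a₁⁴ − 6a₁²a₂ − 2a₂² − 7a₁a₃ + a₄)/5` (a `3`-adic integer) and `‖G₅‖ ≤ 9`, `‖G₆‖ ≤ 27`,
  `‖G₇‖ ≤ 9`, `‖G₈‖ ≤ 3`, `‖G₉‖ ≤ 1`. This is the input of the deep-point numerator law (part 3): together
  with `log₃` to second order it gives `ℓ² ≡ x⁻¹ − (b₂/12)x⁻²` and the `ℓ⁴`-level cancellation.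

References: [SilvermanAEC2009] IV.1, IV.5–6, VI.3 (the `℘`-expansion), VII.2; tree: part 1 (`…DeepSeries`),
part 3 of the first-order chain (`norm_pow_three_div_sq_sub_le`), ui-o2 `O2SigmaValuation`.
-/

noncomputable section

open scoped Classical Nat
open Filter Topology IsUltrametricDist PowerSeries
open WeierstrassCurve Literature.NumberTheory.EllipticCurves
open Literature.NumberTheory.EllipticCurves.SteinWuthrich2013
open Literature.NumberTheory.EllipticCurves.TateCurve
open Literature.NumberTheory.EllipticCurves.Rank1Residual
open Summit.BirchSwinnertonDyer.Uniform.UI.O2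

namespace Summit.BirchSwinnertonDyer.Rank1Residual.X11b.RegMult.HeightLogNumerator

/-! ### §5b `x·ℓ² = 1 − (b₂/12)ℓ² + (c₄/240)ℓ⁴ + O(‖x‖⁻²)`: the theorem -/

section WeierstrassP

variable (V : WeierstrassCurve ℚ_[3]) [V.IsIntegral ℤ_[3]]

/-- **`x = ℘(ℓ) − b₂/12` to fourth order, `3`-adically.** For a `3`-integral Weierstrass equation over `ℚ₃`
and a point `(x, y)` on it with `‖z‖₃ ≤ 3⁻²` (`z = −x/y`; i.e. `‖x‖₃ ≥ 3⁴`), with `ℓ = log_W(z)`: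
`‖x·ℓ² − 1 + (b₂/12)·ℓ² − (c₄/240)·ℓ⁴‖₃ ≤ ‖x‖₃⁻²` (`= ‖z‖₃⁴`). The coefficients are those of the
classical Laurent expansion of `x` in the formal logarithm (`℘(u) = u⁻² + (c₄/240)u² + (c₆/6048)u⁴ + …`,
`x = ℘ − b₂/12`); the next term `(c₆/6048)ℓ⁶` has norm `≤ 27‖z‖⁶ ≤ ‖z‖⁴` in this range, which is why the
statement stops here. Proof: equation and formal logarithm to fourth order (part 1), then the exact
polynomial identity described in the module docstring. [cite: SilvermanAEC2009, IV.1, IV.6.4, VI.3.5] -/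
theorem norm_x_mul_formalLog_sq_sub_le {x y : ℚ_[3]} (heq : V.toAffine.Equation x y) (hx : 1 < ‖x‖)
    (hz9 : ‖-x / y‖ ≤ 1 / 9) :
    ‖x * V.padicFormalLog (-x / y) ^ 2 - 1 + V.b₂ / 12 * V.padicFormalLog (-x / y) ^ 2 -
        V.c₄ / 240 * V.padicFormalLog (-x / y) ^ 4‖ ≤ ‖x‖⁻¹ ^ 2 := by
  set z : ℚ_[3] := -x / y with hzdef
  set ℓ : ℚ_[3] := V.padicFormalLog z with hℓdef
  -- norms of `x, y, z`
  obtain ⟨ha1, ha2, ha3, ha4, -⟩ := V.norm_coeffs_le_one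
  obtain ⟨hsq, hxyn⟩ := V.norm_sq_eq_norm_cube heq hx
  have hx0 : 0 < ‖x‖ := one_pos.trans hx
  have hx0' : x ≠ 0 := norm_pos_iff.mp hx0
  have hy0n : 0 < ‖y‖ := hx0.trans hxyn
  have hy0 : y ≠ 0 := norm_pos_iff.mp hy0n
  have hz2 : ‖z‖ ^ 2 = ‖x‖⁻¹ := by
    rw [hzdef, norm_div, norm_neg, div_pow, hsq]; field_simp
  have hzz : 0 < ‖z‖ := by rw [hzdef, norm_div, norm_neg]; positivity
  have hz0 : z ≠ 0 := norm_pos_iff.mp hzz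
  have hz3 : ‖z‖ ≤ 1 / 3 := hz9.trans (by norm_num)
  have hXz : ‖x‖ * ‖z‖ ^ 2 = 1 := by rw [hz2, mul_inv_cancel₀ hx0.ne']
  have hr4 : ‖x‖⁻¹ ^ 2 = ‖z‖ ^ 4 := by rw [← hz2]; ring
  obtain ⟨hz1, h3z, h9z, h27z2, h3z2, hz2le, hr5, hr6, hr7, hr8, hr9, h3r5, hr6', hr5'⟩ :=
    deep_numerics ‖z‖ hzz hz9
  obtain ⟨h2n, h4n, h3n, h3i, h9i, h12i, -, -, -, -⟩ := padic_three_constants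
  have h5n : ‖(5 : ℚ_[3])‖ = 1 := by
    simpa using Padic.norm_natCast_eq_one_iff.mpr (show Nat.Coprime 3 5 by decide)
  have h240i : ‖(240 : ℚ_[3])⁻¹‖ = 3 := by
    have h80 : ‖(80 : ℚ_[3])‖ = 1 := by
      simpa using Padic.norm_natCast_eq_one_iff.mpr (show Nat.Coprime 3 80 by decide)
    rw [show (240 : ℚ_[3]) = 80 * 3 by norm_num, mul_inv, norm_mul, h3i, norm_inv, h80]; norm_num
  -- Step A: the equation to fourth order
  set ρ : ℚ_[3] := x * z ^ 2 - 1 + V.a₁ * z + V.a₂ * z ^ 2 + V.a₃ * z ^ 3 with hρdef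
  have hρ : ‖ρ‖ ≤ ‖z‖ ^ 4 := by
    have e : ρ = x ^ 3 / y ^ 2 - 1 - V.a₁ * (x / y) + V.a₂ * (x / y) ^ 2 - V.a₃ * (x / y) ^ 3 := by
      rw [hρdef, hzdef]; field_simp; ring
    rw [e, ← hr4]
    exact norm_pow_three_div_sq_sub_quartic_le heq hx
  -- Step B: the formal logarithm to fourth order, `ℓ = z·S + τ`
  set α : ℚ_[3] := (2 : ℚ_[3])⁻¹ * V.a₁ with hαdef
  set β : ℚ_[3] := (3 : ℚ_[3])⁻¹ * (V.a₁ ^ 2 + V.a₂) with hβdef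
  set γ : ℚ_[3] := (4 : ℚ_[3])⁻¹ * (V.a₁ ^ 3 + 2 * V.a₁ * V.a₂ + 2 * V.a₃) with hγdef
  set τ : ℚ_[3] := ℓ - (z + (2 : ℚ_[3])⁻¹ * V.a₁ * z ^ 2 + (3 : ℚ_[3])⁻¹ * (V.a₁ ^ 2 + V.a₂) * z ^ 3 +
    (4 : ℚ_[3])⁻¹ * (V.a₁ ^ 3 + 2 * V.a₁ * V.a₂ + 2 * V.a₃) * z ^ 4) with hτdef
  have hτ : ‖τ‖ ≤ ‖z‖ ^ 5 := norm_padicFormalLog_sub_quartic_le_pow_five V hz3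
  set S : ℚ_[3] := 1 + α * z + β * z ^ 2 + γ * z ^ 3 with hSdef
  have hℓS : ℓ = z * S + τ := by rw [hτdef, hSdef, hαdef, hβdef, hγdef]; ring
  have hα : ‖α‖ ≤ 1 := by rw [hαdef, norm_mul, norm_inv, h2n, inv_one, one_mul]; exact ha1
  have ha12 : ‖V.a₁ ^ 2 + V.a₂‖ ≤ 1 :=
    (norm_add_le_max _ _).trans (max_le (by rw [norm_pow]; exact pow_le_one₀ (norm_nonneg _) ha1) ha2)
  have hβ : ‖β‖ ≤ 3 := by
    rw [hβdef, norm_mul, h3i]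
    calc 3 * ‖V.a₁ ^ 2 + V.a₂‖ ≤ 3 * 1 := by gcongr
      _ = 3 := mul_one _
  have hγ : ‖γ‖ ≤ 1 := by
    rw [hγdef, norm_mul, norm_inv, h4n, inv_one, one_mul]
    refine (norm_add_le_max _ _).trans (max_le ((norm_add_le_max _ _).trans (max_le ?_ ?_)) ?_)
    · rw [norm_pow]; exact pow_le_one₀ (norm_nonneg _) ha1
    · rw [norm_mul, norm_mul, h2n, one_mul]
      calc ‖V.a₁‖ * ‖V.a₂‖ ≤ 1 * 1 := by gcongr
        _ = 1 := one_mul _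
    · rw [norm_mul, h2n, one_mul]; exact ha3
  have hS1 : ‖S - 1‖ ≤ ‖z‖ := by
    rw [hSdef, show 1 + α * z + β * z ^ 2 + γ * z ^ 3 - 1 = z * (α + β * z + γ * z ^ 2) by ring, norm_mul]
    have hin : ‖α + β * z + γ * z ^ 2‖ ≤ 1 := by
      refine (norm_add_le_max _ _).trans (max_le ((norm_add_le_max _ _).trans (max_le hα ?_)) ?_)
      · rw [norm_mul]
        calc ‖β‖ * ‖z‖ ≤ 3 * ‖z‖ := by gcongr
          _ ≤ 1 := h3z
      · rw [norm_mul, norm_pow]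
        calc ‖γ‖ * ‖z‖ ^ 2 ≤ 1 * ‖z‖ ^ 2 := by gcongr
          _ ≤ 1 := by rw [one_mul]; exact hz2le.trans hz1
    calc ‖z‖ * ‖α + β * z + γ * z ^ 2‖ ≤ ‖z‖ * 1 := by gcongr
      _ = ‖z‖ := mul_one _
  have hSn : ‖S‖ ≤ 1 := by
    rw [show S = (S - 1) + 1 by ring]
    exact (norm_add_le_max _ _).trans (max_le (hS1.trans hz1) (by simp))
  have hℓn : ‖ℓ‖ ≤ ‖z‖ := by
    rw [hℓS]
    refine (norm_add_le_max _ _).trans (max_le ?_ (hτ.trans ?_))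
    · rw [norm_mul]
      calc ‖z‖ * ‖S‖ ≤ ‖z‖ * 1 := by gcongr
        _ = ‖z‖ := mul_one _
    · calc ‖z‖ ^ 5 = ‖z‖ ^ 4 * ‖z‖ := by ring
        _ ≤ 1 * ‖z‖ := by gcongr; exact pow_le_one₀ (norm_nonneg _) hz1
        _ = ‖z‖ := one_mul _
  -- Step C: the three perturbations
  -- (C1) `x ℓ² = (x z²) S² + x(2 z S τ + τ²)`, `x z² = (1 − a₁z − a₂z² − a₃z³) + ρ`
  have hC1 : ‖x * ℓ ^ 2 - (1 - V.a₁ * z - V.a₂ * z ^ 2 - V.a₃ * z ^ 3) * S ^ 2‖ ≤ ‖z‖ ^ 4 := by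
    have e : x * ℓ ^ 2 - (1 - V.a₁ * z - V.a₂ * z ^ 2 - V.a₃ * z ^ 3) * S ^ 2 =
        ρ * S ^ 2 + x * (2 * z * S * τ + τ ^ 2) := by
      rw [hℓS, hρdef]; ring
    rw [e]
    refine (norm_add_le_max _ _).trans (max_le ?_ ?_)
    · rw [norm_mul, norm_pow]
      calc ‖ρ‖ * ‖S‖ ^ 2 ≤ ‖z‖ ^ 4 * 1 ^ 2 := by gcongr
        _ = ‖z‖ ^ 4 := by ring
    · rw [norm_mul]
      have hin : ‖2 * z * S * τ + τ ^ 2‖ ≤ ‖z‖ ^ 6 := by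
        refine (norm_add_le_max _ _).trans (max_le ?_ ?_)
        · rw [norm_mul, norm_mul, norm_mul, h2n, one_mul]
          calc ‖z‖ * ‖S‖ * ‖τ‖ ≤ ‖z‖ * 1 * ‖z‖ ^ 5 := by gcongr
            _ = ‖z‖ ^ 6 := by ring
        · rw [norm_pow]
          calc ‖τ‖ ^ 2 ≤ (‖z‖ ^ 5) ^ 2 := by gcongr
            _ = ‖z‖ ^ 6 * ‖z‖ ^ 4 := by ring
            _ ≤ ‖z‖ ^ 6 * 1 := by gcongr; exact pow_le_one₀ (norm_nonneg _) hz1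
            _ = ‖z‖ ^ 6 := mul_one _
      calc ‖x‖ * ‖2 * z * S * τ + τ ^ 2‖ ≤ ‖x‖ * ‖z‖ ^ 6 := by gcongr
        _ = (‖x‖ * ‖z‖ ^ 2) * ‖z‖ ^ 4 := by ring
        _ = ‖z‖ ^ 4 := by rw [hXz, one_mul]
  -- (C2) `(b₂/12) ℓ² = (b₂/12) z² S² + (b₂/12)(2 z S τ + τ²)`
  have hb2 : ‖V.b₂‖ ≤ 1 := by
    have e := congrArg WeierstrassCurve.b₂ V.eq_map_integralModel
    rw [map_b₂] at e
    rw [← e]; exact PadicInt.norm_le_one _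
  have hc4 : ‖V.c₄‖ ≤ 1 := by
    have e := congrArg WeierstrassCurve.c₄ V.eq_map_integralModel
    rw [map_c₄] at e
    rw [← e]; exact PadicInt.norm_le_one _
  have hb12 : ‖V.b₂ / 12‖ ≤ 3 := by
    rw [div_eq_mul_inv, norm_mul, h12i]
    calc ‖V.b₂‖ * 3 ≤ 1 * 3 := by gcongr
      _ = 3 := one_mul _
  have hc240 : ‖V.c₄ / 240‖ ≤ 3 := by
    rw [div_eq_mul_inv, norm_mul, h240i]
    calc ‖V.c₄‖ * 3 ≤ 1 * 3 := by gcongr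
      _ = 3 := one_mul _
  have hC2 : ‖V.b₂ / 12 * ℓ ^ 2 - V.b₂ / 12 * (z ^ 2 * S ^ 2)‖ ≤ ‖z‖ ^ 4 := by
    rw [← mul_sub, show ℓ ^ 2 - z ^ 2 * S ^ 2 = 2 * z * S * τ + τ ^ 2 by rw [hℓS]; ring, norm_mul]
    have hin : ‖2 * z * S * τ + τ ^ 2‖ ≤ ‖z‖ ^ 6 := by
      refine (norm_add_le_max _ _).trans (max_le ?_ ?_)
      · rw [norm_mul, norm_mul, norm_mul, h2n, one_mul]
        calc ‖z‖ * ‖S‖ * ‖τ‖ ≤ ‖z‖ * 1 * ‖z‖ ^ 5 := by gcongr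
          _ = ‖z‖ ^ 6 := by ring
      · rw [norm_pow]
        calc ‖τ‖ ^ 2 ≤ (‖z‖ ^ 5) ^ 2 := by gcongr
          _ = ‖z‖ ^ 6 * ‖z‖ ^ 4 := by ring
          _ ≤ ‖z‖ ^ 6 * 1 := by gcongr; exact pow_le_one₀ (norm_nonneg _) hz1
          _ = ‖z‖ ^ 6 := mul_one _
    calc ‖V.b₂ / 12‖ * ‖2 * z * S * τ + τ ^ 2‖ ≤ 3 * ‖z‖ ^ 6 := by gcongr
      _ = (3 * ‖z‖ ^ 2) * ‖z‖ ^ 4 := by ring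
      _ ≤ 1 * ‖z‖ ^ 4 := by gcongr
      _ = ‖z‖ ^ 4 := one_mul _
  -- (C3) `(c₄/240) ℓ⁴ = (c₄/240) z⁴ + (c₄/240)(ℓ⁴ − z⁴)`, `‖ℓ² − z²‖ ≤ ‖z‖³`
  have hℓz : ‖ℓ ^ 2 - z ^ 2‖ ≤ ‖z‖ ^ 3 := by
    rw [show ℓ ^ 2 - z ^ 2 = z ^ 2 * ((S - 1) * (S + 1)) + (2 * z * S * τ + τ ^ 2) by rw [hℓS]; ring]
    have hS1' : ‖S + 1‖ ≤ 1 := (norm_add_le_max _ _).trans (max_le hSn (by simp))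
    refine (norm_add_le_max _ _).trans (max_le ?_ ?_)
    · rw [norm_mul, norm_mul, norm_pow]
      calc ‖z‖ ^ 2 * (‖S - 1‖ * ‖S + 1‖) ≤ ‖z‖ ^ 2 * (‖z‖ * 1) := by gcongr
        _ = ‖z‖ ^ 3 := by ring
    · refine (norm_add_le_max _ _).trans (max_le ?_ ?_)
      · rw [norm_mul, norm_mul, norm_mul, h2n, one_mul]
        calc ‖z‖ * ‖S‖ * ‖τ‖ ≤ ‖z‖ * 1 * ‖z‖ ^ 5 := by gcongr
          _ = ‖z‖ ^ 3 * (‖z‖ ^ 3) := by ring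
          _ ≤ ‖z‖ ^ 3 * 1 := by gcongr; exact pow_le_one₀ (norm_nonneg _) hz1
          _ = ‖z‖ ^ 3 := mul_one _
      · rw [norm_pow]
        calc ‖τ‖ ^ 2 ≤ (‖z‖ ^ 5) ^ 2 := by gcongr
          _ = ‖z‖ ^ 3 * ‖z‖ ^ 7 := by ring
          _ ≤ ‖z‖ ^ 3 * 1 := by gcongr; exact pow_le_one₀ (norm_nonneg _) hz1
          _ = ‖z‖ ^ 3 := mul_one _
  have hC3 : ‖V.c₄ / 240 * ℓ ^ 4 - V.c₄ / 240 * z ^ 4‖ ≤ ‖z‖ ^ 4 := by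
    rw [← mul_sub, show ℓ ^ 4 - z ^ 4 = (ℓ ^ 2 - z ^ 2) * (ℓ ^ 2 + z ^ 2) by ring, norm_mul, norm_mul]
    have hsum : ‖ℓ ^ 2 + z ^ 2‖ ≤ ‖z‖ ^ 2 := by
      refine (norm_add_le_max _ _).trans (max_le ?_ (by rw [norm_pow]))
      rw [norm_pow]; exact pow_le_pow_left₀ (norm_nonneg _) hℓn 2
    calc ‖V.c₄ / 240‖ * (‖ℓ ^ 2 - z ^ 2‖ * ‖ℓ ^ 2 + z ^ 2‖) ≤ 3 * (‖z‖ ^ 3 * ‖z‖ ^ 2) := by gcongr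
      _ = 3 * ‖z‖ ^ 5 := by ring
      _ ≤ ‖z‖ ^ 4 := h3r5
  -- Step D: the exact polynomial part (`deep_poly_bound`) and the assembly
  have hb2def : V.b₂ = V.a₁ ^ 2 + 4 * V.a₂ := rfl
  have hc4def : V.c₄ = V.b₂ ^ 2 - 24 * V.b₄ := rfl
  have hb4def : V.b₄ = 2 * V.a₄ + V.a₁ * V.a₃ := rfl
  have hpoly : ‖(1 - V.a₁ * z - V.a₂ * z ^ 2 - V.a₃ * z ^ 3) * S ^ 2 - 1 + V.b₂ / 12 * (z ^ 2 * S ^ 2) -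
      V.c₄ / 240 * z ^ 4‖ ≤ ‖z‖ ^ 4 := by
    have h := deep_poly_bound ha1 ha2 ha3 ha4 hzz hz9
    rw [hSdef, hαdef, hβdef, hγdef, hc4def, hb4def, hb2def]
    exact h
  clear_value ℓ z
  have hfin : x * ℓ ^ 2 - 1 + V.b₂ / 12 * ℓ ^ 2 - V.c₄ / 240 * ℓ ^ 4 =
      (x * ℓ ^ 2 - (1 - V.a₁ * z - V.a₂ * z ^ 2 - V.a₃ * z ^ 3) * S ^ 2) +
      (V.b₂ / 12 * ℓ ^ 2 - V.b₂ / 12 * (z ^ 2 * S ^ 2)) - (V.c₄ / 240 * ℓ ^ 4 - V.c₄ / 240 * z ^ 4) +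
      ((1 - V.a₁ * z - V.a₂ * z ^ 2 - V.a₃ * z ^ 3) * S ^ 2 - 1 + V.b₂ / 12 * (z ^ 2 * S ^ 2) -
        V.c₄ / 240 * z ^ 4) := by ring
  rw [hfin, hr4]
  refine (norm_add_le_max _ _).trans (max_le ((norm_sub_le_max₃ _ _).trans (max_le
    ((norm_add_le_max _ _).trans (max_le hC1 hC2)) hC3)) hpoly)

end WeierstrassP

end Summit.BirchSwinnertonDyer.Rank1Residual.X11b.RegMult.HeightLogNumerator

end
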